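import Literature.NumberTheory.Rogawski1990.LocalStableClassesNonsplit                  -- ★ B-p04: eigenframe algebra (`conj_eq_diagonal_of_commute`, `twistGram_eigenframe_eq_diagonal`)
import Literature.NumberTheory.Automorphic.UnitOrbitalIntegralFixedPointsPair          -- ★ `compactSpace_cmDatum_local_one_of_smul_eq` (`U(Φ₁)_v` compact at non-split `v`)
import Literature.NumberTheory.Automorphic.LocalRegularOrbitClosed                     -- ★ `map_conjLocal_transpose_localForm`, `isUnit_det_localForm`
import Literature.NumberTheory.Automorphic.UnitaryGroupInertPlaceHyperbolicBasis       -- ★ `LocalRing.isField_of_smul_eq`, `galAdicCompletionMap_galAdicCompletionMap_of_smul_eq`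
import Literature.NumberTheory.Automorphic.UnitaryGroupLocalFactors                     -- ★ `continuous_conjLocal`
import Literature.NumberTheory.GelbartRogawski1991.UnitaryDualPairThetaKernelCM          -- ★ `imagUnit` (for `conjLocal_conjLocal`)
import HarnessLib

/-!
# Elliptic regular elements of `U(H)(L⁺_v)` at a NON-SPLIT place have COMPACT centralisers (the anisotropic torus `(L_w¹)ᴺ` in an eigenframe)

Topic `NumberTheory/Automorphic`; namespace `Literature.NumberTheory.Automorphic.UnitaryGroup`.  THEOREMS ONLY (no definition, no instance, no notation, no named
fact, no `sorry`).  Cell `pub/hodgecm-mathlib`, F0∕P3a road «D-N7-inert» ∕ MAP v3 (F9)–(F12): brick **(E4)** of the (S1-bis) payer of `stub_countSplitClause` (B-p10 (g24);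
A-p06 (g26) 04:21:44Z) — it discharges the `[CompactSpace Z(γ₂)]` instance of ★ (L2)-PAIR p840404 ∕ ★ p840855 and the `hcpt` binder of ★ p840855 for BOTH classes of the
stable class.  HC_CM is proved only modulo the printed citations until rung 0 closes; this file is unconditional.

THE MATHEMATICS [Rogawski1990, §3.5 p. 29, §3.6]: `δ ∈ U(H)(L⁺_v) ⊂ GL_N(E_v)`, `E_v = L ⊗ L⁺_v = L_w` (`v` non-split), with an eigenframe `δ Q = Q · diag(u)`, `uᵢ` pairwise
distinct of norm one (`σ(uᵢ) uᵢ = 1`: the ELLIPTIC torus of type `(L¹)ᴺ`).  Anything commuting with `δ` is `Q · diag(t) · Q⁻¹` (★ `conj_eq_diagonal_of_commute`); it is unitary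
iff `σ(tᵢ) tᵢ = 1` (the Gram matrix `H_Q` is diagonal with non-zero entries, ★ `twistGram_eigenframe_eq_diagonal`).  So `Z_{U}(δ)` is the continuous image of `(L_w¹)ᴺ`,
and `L_w¹ = U(Φ₁)(L⁺_v)` is compact (★ `compactSpace_cmDatum_local_one_of_smul_eq`).

* §1 `isCompact_setOf_conjLocal_mul_self_eq_one` — `{x ∈ E_v : σ(x) x = 1}` is compact at a non-split `v`.
* §2 `exists_normOne_diagonal_of_mem_centralizer` ∕ `conj_diagonal_mem_local_and_commute` — the two inclusions.
* §3 **`compactSpace_centralizer_of_eigenframe_of_smul_eq`** — `CompactSpace (Subgroup.centralizer {δ})`.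

## References
* [Rogawski1990] J. D. Rogawski, *Automorphic Representations of Unitary Groups in Three Variables* (1990), §3.5 p. 29, §3.6 pp. 31–32.
* [PlatonovRapinchuk1994] V. Platonov, A. Rapinchuk, *Algebraic Groups and Number Theory* (1994), §2.3, §3.3 (compactness of anisotropic tori over local fields).
-/

set_option autoImplicit false

noncomputable section

open NumberField IsDedekindDomain Matrix Topology
open scoped Matrix MatrixGroups

namespace Literature.NumberTheory.Automorphic.UnitaryGroup

open Literature.NumberTheory.Rogawski1990
open Literature.AlgebraicGeometry.ShimuraVarieties (unitaryGroup mem_unitaryGroup_iff)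

variable (L : Type) [Field L] [NumberField L] [IsCMField L] {v : HeightOneSpectrum (𝓞 ↥(maximalRealSubfield L))}
  (w : PlacesOver L v) (hw : IsCMField.complexConj L • w.1 = w.1)

/-! ## §1 The norm-one set of `E_v` is compact at a non-split place -/

include hw in
/-- **`L_w¹ = {x ∈ E_v : σ(x) x = 1}` is compact** at a non-split `v`: it is the continuous image `g ↦ g₀₀` of the compact group `U(Φ₁)(L⁺_v)`
(★ `compactSpace_cmDatum_local_one_of_smul_eq`). [cite: PlatonovRapinchuk1994, §3.3] -/
theorem isCompact_setOf_conjLocal_mul_self_eq_one :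
    IsCompact {x : LocalRing L v | conjLocal L (IsCMField.complexConj L) v x * x = 1} := by
  haveI := compactSpace_cmDatum_local_one_of_smul_eq L (Matrix.of fun i j : Fin 1 => if i.val + j.val + 1 = 1 then (1 : L) else 0) w hw
    (isUnit_placeForm_antidiagOne (E := L) 1 w.1)
  -- the local form of `Φ₁` is the `1 × 1` matrix `(1)`
  have hΦ : ((adelicForm L 1 (Matrix.of fun i j : Fin 1 => if i.val + j.val + 1 = 1 then (1 : L) else 0)).map (adeleToLocal L v)) 0 0 = 1 := by
    rw [adelicForm_map_adeleToLocal, Matrix.map_apply, Matrix.of_apply]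
    simp
  have h11 : ∀ (A B C : Matrix (Fin 1) (Fin 1) (LocalRing L v)), (A * B * C) 0 0 = A 0 0 * B 0 0 * C 0 0 := fun A B C => by
    simp [Matrix.mul_apply]
  let f : (cmDatum L 1 (Matrix.of fun i j : Fin 1 => if i.val + j.val + 1 = 1 then (1 : L) else 0)).Local v → LocalRing L v :=
    fun g => g.val.val 0 0
  have hf : Continuous f := (Units.continuous_val.comp continuous_subtype_val).matrix_elem 0 0
  have hrange : Set.range f = {x : LocalRing L v | conjLocal L (IsCMField.complexConj L) v x * x = 1} := by
    ext x
    simp only [Set.mem_range, Set.mem_setOf_eq]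
    constructor
    · rintro ⟨g, rfl⟩
      have hg := mem_unitaryGroupOfForm_iff.1 g.2
      have h := congrFun (congrFun hg 0) 0
      rw [h11, hΦ, mul_one, Matrix.transpose_apply, Matrix.map_apply] at h
      exact h
    · intro hx
      have hxu : IsUnit x := isUnit_iff_exists_inv'.2 ⟨_, hx⟩
      have hdet : IsUnit (!![x] : Matrix (Fin 1) (Fin 1) (LocalRing L v)).det := by
        rw [Matrix.det_fin_one_of]; exact hxu
      refine ⟨⟨Matrix.GeneralLinearGroup.mk'' _ hdet, mem_unitaryGroupOfForm_iff.2 (Matrix.ext fun i j => ?_)⟩, rfl⟩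
      obtain rfl : i = 0 := Subsingleton.elim _ _
      obtain rfl : j = 0 := Subsingleton.elim _ _
      rw [h11, hΦ, mul_one, Matrix.transpose_apply, Matrix.map_apply]
      exact hx
  rw [← hrange]
  exact isCompact_range hf

/-! ## §2 The centraliser of an elliptic regular element in its eigenframe (any field) -/

section Frame

variable {K : Type*} [Field K] (σ : K →+* K) {n : Type*} [Fintype n] [DecidableEq n] (H : Matrix n n K)

/-- **Anything UNITARY commuting with `γ` is `Q · diag(t) · Q⁻¹` with `σ(tᵢ) tᵢ = 1`**: for `γ ∈ U(σ, H)` with eigenframe `γ Q = Q diag(u)` (`uᵢ` distinct of norm one),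
`det H ≠ 0`, and `z ∈ U(σ, H)` commuting with `γ`: `Q⁻¹ z Q = diag(t)` (★ `conj_eq_diagonal_of_commute`) and `σ(tᵢ) tᵢ = 1` (the Gram matrix `H_Q` is diagonal with
non-zero entries, ★ `twistGram_eigenframe_eq_diagonal`, and `H_{zQ} = H_Q`). [cite: Rogawski1990, §3.5 p. 29] -/
theorem exists_normOne_diagonal_of_commute_of_mem_unitaryGroup (hHd : H.det ≠ 0) {γ : GL n K} (hγ : γ ∈ unitaryGroup σ H) {Q : GL n K} {u : n → K}
    (hQ : γ.val * Q.val = Q.val * diagonal u) (hu : Function.Injective u) (hu1 : ∀ i, σ (u i) * u i = 1)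
    {z : GL n K} (hzU : z ∈ unitaryGroup σ H) (hcomm : Commute z.val γ.val) :
    ∃ t : n → K, (∀ i, σ (t i) * t i = 1) ∧ z.val = Q.val * diagonal t * (Q⁻¹).val := by
  set t : n → K := fun i => ((Q⁻¹).val * z.val * Q.val) i i with ht
  have hD : (Q⁻¹).val * z.val * Q.val = diagonal t := conj_eq_diagonal_of_commute hQ hu hcomm
  have hzQ : z.val = Q.val * diagonal t * (Q⁻¹).val := by
    rw [← hD]
    calc z.val = (Q.val * (Q⁻¹).val) * z.val * (Q.val * (Q⁻¹).val) := by rw [Units.mul_inv, Matrix.one_mul, Matrix.mul_one]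
      _ = Q.val * ((Q⁻¹).val * z.val * Q.val) * (Q⁻¹).val := by simp only [Matrix.mul_assoc]
  refine ⟨t, fun i => ?_, hzQ⟩
  -- `H_{zQ} = H_Q` (z unitary) and `z Q = Q diag(t)`
  have hzQ' : z.val * Q.val = Q.val * diagonal t := by
    rw [hzQ, Matrix.mul_assoc (Q.val * diagonal t), Units.inv_mul, Matrix.mul_one]
  have h1 : twistGram σ H (z.val * Q.val) = twistGram σ H Q.val := twistGram_unitary_mul σ H hzU _
  have h2 : twistGram σ H (Q.val * diagonal t) = (diagonal fun m => σ (t m)) * twistGram σ H Q.val * diagonal t := by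
    rw [twistGram_mul, Matrix.diagonal_map (map_zero σ), Matrix.diagonal_transpose]
  rw [hzQ', h2, twistGram_eigenframe_eq_diagonal σ H hγ hQ hu hu1, diagonal_mul_diagonal, diagonal_mul_diagonal] at h1
  have hi := congrFun (congrFun h1 i) i
  simp only [diagonal_apply_eq] at hi
  -- `σ(tᵢ) dᵢ tᵢ = dᵢ`, `dᵢ ≠ 0`
  have hd : twistGram σ H Q.val i i ≠ 0 := twistGram_eigenframe_apply_ne_zero σ H hHd hγ hQ hu hu1 i
  have : σ (t i) * t i * twistGram σ H Q.val i i = 1 * twistGram σ H Q.val i i := by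
    calc σ (t i) * t i * twistGram σ H Q.val i i = σ (t i) * twistGram σ H Q.val i i * t i := by ring
      _ = twistGram σ H Q.val i i := hi
      _ = 1 * twistGram σ H Q.val i i := (one_mul _).symm
  exact mul_right_cancel₀ hd this

/-- **Conversely `Q · diag(t) · Q⁻¹ ∈ U(σ, H)` commutes with `γ` when `σ(tᵢ) tᵢ = 1`.** [cite: Rogawski1990, §3.5 p. 29] -/
theorem conj_diagonal_mem_unitaryGroup_of_normOne {γ : GL n K} (hγ : γ ∈ unitaryGroup σ H) {Q : GL n K} {u : n → K}
    (hQ : γ.val * Q.val = Q.val * diagonal u) (hu : Function.Injective u) (hu1 : ∀ i, σ (u i) * u i = 1)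
    {t : n → K} (ht : ∀ i, σ (t i) * t i = 1) {D : GL n K} (hDt : D.val = diagonal t) :
    Q * D * Q⁻¹ ∈ unitaryGroup σ H ∧ Commute (Q * D * Q⁻¹).val γ.val := by
  have hval : (Q * D * Q⁻¹).val = Q.val * diagonal t * (Q⁻¹).val := by
    rw [Units.val_mul, Units.val_mul, hDt]
  refine ⟨mem_unitaryGroup_iff.2 ?_, by rw [hval]; exact commute_eigenframe_diagonal hQ _⟩
  -- `ᵗσ(QDQ⁻¹) H (QDQ⁻¹) = H` ⟸ `ᵗσD H_Q D = H_Q`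
  rw [hval, ← twistGram_def]
  have hQD : twistGram σ H (Q.val * diagonal t) = twistGram σ H Q.val := by
    rw [twistGram_mul, Matrix.diagonal_map (map_zero σ), Matrix.diagonal_transpose, twistGram_eigenframe_eq_diagonal σ H hγ hQ hu hu1,
      diagonal_mul_diagonal, diagonal_mul_diagonal]
    refine congrArg diagonal (funext fun i => ?_)
    calc σ (t i) * twistGram σ H Q.val i i * t i = σ (t i) * t i * twistGram σ H Q.val i i := by ring
      _ = twistGram σ H Q.val i i := by rw [ht i, one_mul]
  rw [twistGram_mul σ H (Q.val * diagonal t) (Q⁻¹).val, hQD, ← twistGram_mul, Units.mul_inv, twistGram_def,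
    Matrix.map_one σ (map_zero σ) (map_one σ), Matrix.transpose_one, Matrix.one_mul, Matrix.mul_one]

end Frame

/-! ## §3 Compactness of the centraliser at a non-split place -/

section Compact

variable {N : ℕ} (H : Matrix (Fin N) (Fin N) L)

include hw in
/-- **ELLIPTIC REGULAR CENTRALISERS ARE COMPACT at a non-split place**: for `H` hermitian with `det H ≠ 0`, `v` non-split (`c • w = w`), and `δ ∈ U(H)(L⁺_v)` with an
eigenframe `δ Q = Q · diag(u)` over `E_v`, `uᵢ` pairwise distinct OF NORM ONE (`σ(uᵢ) uᵢ = 1` — the anisotropic torus `(L_w¹)ᴺ`), the centraliser `Z(δ) ≤ U(H)(L⁺_v)` is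
compact: it is the continuous image `t ↦ Q · diag(t) · Q⁻¹` of `(L_w¹)ᴺ` (§2), and `L_w¹` is compact (§1). [cite: Rogawski1990, §3.6 pp. 31–32] [cite: PlatonovRapinchuk1994, §3.3] -/
theorem compactSpace_centralizer_of_eigenframe_of_smul_eq (hH : (H.map (cmConjRingHom L))ᵀ = H) (hdet : H.det ≠ 0)
    (δ : (cmDatum L N H).Local v) {Q : GL (Fin N) (LocalRing L v)} {u : Fin N → LocalRing L v}
    (hQ : δ.val.val * Q.val = Q.val * diagonal u) (hu : Function.Injective u) (hu1 : ∀ i, conjLocal L (IsCMField.complexConj L) v (u i) * u i = 1) :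
    CompactSpace (Subgroup.centralizer ({δ} : Set ((cmDatum L N H).Local v))) := by
  have hc1 : IsCMField.complexConj L ≠ 1 := IsCMField.complexConj_ne_one L
  have hHh : ((((adelicForm L N H).map (adeleToLocal L v))).map (conjLocal L (IsCMField.complexConj L) v))ᵀ = (adelicForm L N H).map (adeleToLocal L v) :=
    map_conjLocal_transpose_localForm L N H v hH
  have hHd : ((adelicForm L N H).map (adeleToLocal L v)).det ≠ 0 := (isUnit_det_localForm L N H v hdet).ne_zero
  have hδU : δ.val ∈ unitaryGroup (conjLocal L (IsCMField.complexConj L) v) ((adelicForm L N H).map (adeleToLocal L v)) :=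
    (mem_unitaryGroup_iff (σ := conjLocal L (IsCMField.complexConj L) v) (H := ((adelicForm L N H).map (adeleToLocal L v))) (g := δ.val)).2
      ((mem_unitaryGroupOfForm_iff (σ := conjLocal L (IsCMField.complexConj L) v) (J := ((adelicForm L N H).map (adeleToLocal L v))) (g := δ.val)).1 δ.2)
  have hσσ : ∀ x, conjLocal L (IsCMField.complexConj L) v (conjLocal L (IsCMField.complexConj L) v x) = x :=
    conjLocal_conjLocal (IsCMField.complexConj L) v (GelbartRogawski1991.UnitaryDualPair.complexConj_imagUnit L)
      (GelbartRogawski1991.UnitaryDualPair.imagUnit_ne_zero L)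
  -- the norm-one torus `(L_w¹)ᴺ`
  haveI : CompactSpace {x : LocalRing L v // conjLocal L (IsCMField.complexConj L) v x * x = 1} :=
    isCompact_iff_compactSpace.1 (isCompact_setOf_conjLocal_mul_self_eq_one L w hw)
  -- norm-one elements as units (inverse `σ x`)
  let un : {x : LocalRing L v // conjLocal L (IsCMField.complexConj L) v x * x = 1} → (LocalRing L v)ˣ :=
    fun x => ⟨x.1, conjLocal L (IsCMField.complexConj L) v x.1, by rw [mul_comm]; exact x.2, x.2⟩
  -- the parametrisation `t ↦ Q · diag(t) · Q⁻¹`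
  let g : (Fin N → {x : LocalRing L v // conjLocal L (IsCMField.complexConj L) v x * x = 1}) → GL (Fin N) (LocalRing L v) :=
    fun t => Q * glDiagonal N (LocalRing L v) (fun i => un (t i)) * Q⁻¹
  have hgval : ∀ t, (g t).val = Q.val * diagonal (fun i => ((t i).1 : LocalRing L v)) * (Q⁻¹).val := fun t => by
    show (Q * glDiagonal N (LocalRing L v) (fun i => un (t i)) * Q⁻¹).val = _
    rw [Units.val_mul, Units.val_mul, coe_glDiagonal]
  have hginv : ∀ t, ((g t)⁻¹).val = Q.val * diagonal (fun i => conjLocal L (IsCMField.complexConj L) v (t i).1) * (Q⁻¹).val := fun t => by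
    show ((Q * glDiagonal N (LocalRing L v) (fun i => un (t i)) * Q⁻¹)⁻¹).val = _
    rw [_root_.mul_inv_rev, _root_.mul_inv_rev, inv_inv, ← mul_assoc, ← map_inv, Units.val_mul, Units.val_mul, coe_glDiagonal]
    rfl
  -- §2: membership and commutation (over the FIELD `E_v = L_w`)
  have hmem : ∀ t, g t ∈ unitaryGroup (conjLocal L (IsCMField.complexConj L) v) ((adelicForm L N H).map (adeleToLocal L v)) ∧
      Commute (g t).val δ.val.val := fun t => by
    letI : Field (LocalRing L v) := (LocalRing.isField_of_smul_eq (IsCMField.complexConj L) hc1 w hw).toField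
    exact conj_diagonal_mem_unitaryGroup_of_normOne (conjLocal L (IsCMField.complexConj L) v) _ hδU hQ hu hu1
      (t := fun i => ((t i).1 : LocalRing L v)) (fun i => (t i).2) (D := glDiagonal N (LocalRing L v) (fun i => un (t i)))
      (coe_glDiagonal N (LocalRing L v) fun i => un (t i))
  have hsurj0 : ∀ z : (cmDatum L N H).Local v, z ∈ Subgroup.centralizer ({δ} : Set ((cmDatum L N H).Local v)) →
      ∃ t : Fin N → LocalRing L v, (∀ i, conjLocal L (IsCMField.complexConj L) v (t i) * t i = 1) ∧
        z.val.val = Q.val * diagonal t * (Q⁻¹).val := fun z hz => by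
    have hzU : z.val ∈ unitaryGroup (conjLocal L (IsCMField.complexConj L) v) ((adelicForm L N H).map (adeleToLocal L v)) :=
      (mem_unitaryGroup_iff (σ := conjLocal L (IsCMField.complexConj L) v) (H := ((adelicForm L N H).map (adeleToLocal L v))) (g := z.val)).2
        ((mem_unitaryGroupOfForm_iff (σ := conjLocal L (IsCMField.complexConj L) v) (J := ((adelicForm L N H).map (adeleToLocal L v))) (g := z.val)).1 z.2)
    have hcomm : Commute z.val.val δ.val.val := by
      have h := Subgroup.mem_centralizer_iff.1 hz δ (Set.mem_singleton δ)
      have h' : δ.val.val * z.val.val = z.val.val * δ.val.val := congrArg (fun x : (cmDatum L N H).Local v => x.val.val) h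
      exact h'.symm
    letI : Field (LocalRing L v) := (LocalRing.isField_of_smul_eq (IsCMField.complexConj L) hc1 w hw).toField
    exact exists_normOne_diagonal_of_commute_of_mem_unitaryGroup (conjLocal L (IsCMField.complexConj L) v) _ hHd hδU hQ hu hu1 hzU hcomm
  -- the parametrisation as a map into the centraliser
  let ψ : (Fin N → {x : LocalRing L v // conjLocal L (IsCMField.complexConj L) v x * x = 1}) →
      Subgroup.centralizer ({δ} : Set ((cmDatum L N H).Local v)) := fun t =>
    ⟨⟨g t, (mem_unitaryGroupOfForm_iff (σ := conjLocal L (IsCMField.complexConj L) v) (J := ((adelicForm L N H).map (adeleToLocal L v))) (g := g t)).2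
        ((mem_unitaryGroup_iff (σ := conjLocal L (IsCMField.complexConj L) v) (H := ((adelicForm L N H).map (adeleToLocal L v))) (g := g t)).1 (hmem t).1)⟩,
      Subgroup.mem_centralizer_iff.2 fun x hx => by
        rw [Set.mem_singleton_iff] at hx
        subst hx
        exact Subtype.ext (Units.ext (hmem t).2.symm)⟩
  have hψc : Continuous ψ := by
    refine Continuous.subtype_mk (Continuous.subtype_mk ?_ _) _
    refine Units.continuous_iff.2 ⟨?_, ?_⟩
    · refine Continuous.congr ?_ (fun t => (hgval t).symm)
      exact (continuous_const.matrix_mul (Continuous.matrix_diagonal (continuous_pi fun i =>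
        continuous_subtype_val.comp (continuous_apply i)))).matrix_mul continuous_const
    · refine Continuous.congr ?_ (fun t => (hginv t).symm)
      exact (continuous_const.matrix_mul (Continuous.matrix_diagonal (continuous_pi fun i =>
        (continuous_conjLocal L (IsCMField.complexConj L) v).comp (continuous_subtype_val.comp (continuous_apply i))))).matrix_mul
        continuous_const
  have hψs : Function.Surjective ψ := fun z => by
    obtain ⟨t, ht, hz⟩ := hsurj0 z.1 z.2
    refine ⟨fun i => ⟨t i, ht i⟩, Subtype.ext (Subtype.ext (Units.ext ?_))⟩
    rw [hz]
    exact hgval _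
  exact ⟨by rw [← hψs.range_eq]; exact isCompact_range hψc⟩

end Compact

end Literature.NumberTheory.Automorphic.UnitaryGroup

end
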